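import Summits.QuantumFields.YangMills.Theorems.BalabanUVNodesN27SpineRecordJoinSync
import Literature.MathematicalPhysics.QuantumFieldTheory.Balaban1983to89.T4FlagMemoryTwoRun

/-!
# BalabanUVNodes ∕ N27 spine-record join, V — WINDOW MEMBERSHIPS READ OFF `Tuned` TOO: the join of record
# (`hybridNE7Under_of_spineRecordAtDatum_sync`, p412461) restated at the CLAMPED run tables
# `g(g₀, os, K) = extd (prefixOf (runFlow D g₀ (K₀+K)) (K₀+K))` (the `(K₀+K)`-step run's couplings, clamped beyond the run length), for which
# BOTH the box AND the coupling-window memberships of node U3's functionals follow from `D.Tuned γ g g₀`; the only run-dependent K4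
# clause left is the printed-grade `PolyLipGrowth` (companion of files I–IV; cell `pub-ymgap`, HUMAN RULING D-0062 Track A, seat
# `pub-ymgap-dag-n27-a` g2; `--supports stmt-QuantumFields-19182`, count-neutral)

WHY.  Files I∕III asked, under the prefix, `runFlow D g₀ (K₀+K) ∈ Wset` and `(i ↦ runFlow D g₀ (K₀+K+1) (i+1)) ∈ Wset` for the WHOLE
tables `ℕ → ℝ` — including the construction's entries BEYOND the run length, about which `Tuned` says nothing (dag-n19-b's located point (iv),
INBOX l.9327; my dossier's typing note T-2).  The functionals `EA`, `EB` of node U3 read a domain of scale `j ≤ K` through the couplings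
`g i`, `i < j` only (the tree's convention; `PrefixDependenceOn`), and node U2's output `disc (g K) (g (K+1)) j` reads `g K j`, `g (K+1) (j+1)`,
`j ≤ K ≤ K₀ + K` — all INSIDE the run.  So the tables may be CLAMPED at the run's end without changing anything the knit reads:
`T4FlagMemory.extd (FlowStep.prefixOf (runFlow D g₀ n) n)` (`g_m := g_n` for `m > n`), which lies in `T4OutputRate.Window γ` whenever the run
stays in `]0, γ]` (`T4BetaReadOut.extd_mem_window` ∘ `T4CouplingMatching.prefixOf_mem_box`) — i.e. under `D.Tuned γ g g₀`.  With the window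
of the record decls N18∕N22∕`LipBackground` containing `Window γᵤ` for some `γᵤ > 0`, the prefix's `γ`-threshold is shrunk to `≤ γᵤ` inside
the proof and the memberships are DISCHARGED.  The table map enters through a DEFINING hypothesis `hg : ∀ g₀ os K, g g₀ os K = extd (…)` so
that the statement stays readable and an instantiator supplies `hg := fun _ _ _ => rfl`.

WHAT IS KERNEL-CHECKED ([folklore]; 0 `def`, 0 `sorry`).  §1 clamped tables (agreement with the run on its length is the tree's
`T4FlagMemoryTwoRun.extd_prefixOf`, cited): `extd_prefixOf_mem_window` ∕ `extd_prefixOf_succ_mem_window` (both runs' clamped tables in `Window γ` under the box), `injectedRate_clamped`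
(node U2's output along `g₀` ⇒ the `InjectedRate` of the clamped tables from offset `K₀` on).  §2 **`hybridNE7Under_of_spineRecordAtDatum_tuned`**
— `…_sync` with `hRuns` reduced to `PolyLipGrowth`, `hWin : Window γᵤ ⊆ Wset`, and every table the clamped one; box and windows from `Tuned`.

HONEST FRAMING.  Composite-node bookkeeping BY NAME over hypothesis shapes (NE3, NE4's out-edge, NE5, NE9, NE7b, NE7c — none printed for
Bałaban's d = 4 procedure, none proved); nothing of Bałaban's instantiated; NO node discharged; one finite four-torus — NOT ℝ⁴ ∕ OS ∕ mass-gap ∕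
Clay.  Typed 28∕28 · discharged 1∕28 unchanged.  No decl below carries a cite tag ([Balaban1987RG1] Thm 1∕2 p. 259 «]0, γ]» is the located
reason for the window shape, transcribed in `T4OutputRate.Window`'s docstring).
-/

open Finset MeasureTheory

namespace Summit.QuantumFields.YangMills.Theorems.BalabanUVNodesN27SpineRecord

open Literature.MathematicalPhysics.QuantumFieldTheory.Balaban1983to89
open Literature.MathematicalPhysics.QuantumFieldTheory.Balaban1983to89.T4Continuum
open T4OutputRate T4RecentScale T4GoodClassBudget T4CauchySum T4TowerRateComposition T4TowerRateDischarge T4TermwiseBudget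
open T4WeightBudget (RelWeightBound)
open T4IndicatorShell (ShellWeightBound)
open T4EtaRateMin (Readings NE3Shape)
open T4RateLiaison (GaugeDominated)
open T4ContinuumYM4Torus (ForSmallCouplings)
open T4FlagMemory (extd)
open FlowStep (prefixOf)
open Summit.QuantumFields.BalabanUV.T4Continuum.Spine
open Summit.QuantumFields.BalabanUV.T4Continuum.Spine.NE4 (NE4OnData U2Output runFlow)

/-! ## §1 Clamped run tables -/

section Clamped

/-- If the sequence stays in `]0, γ]` up to `n`, the clamped extension of its `n`-prefix lies in the coupling window `Window γ`
(`T4CouplingMatching.prefixOf_mem_box` + `T4BetaReadOut.extd_mem_window`). [folklore] -/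
theorem extd_prefixOf_mem_window {h : ℕ → ℝ} {n : ℕ} {γ : ℝ} (hbox : ∀ i, i ≤ n → 0 < h i ∧ h i ≤ γ) :
    extd (prefixOf h n) ∈ Window γ :=
  T4BetaReadOut.extd_mem_window (T4CouplingMatching.prefixOf_mem_box le_rfl hbox)

/-- … and so does its shift `i ↦ extd (prefixOf h n) (i + 1)` (run B's re-indexed table). [folklore] -/
theorem extd_prefixOf_succ_mem_window {h : ℕ → ℝ} {n : ℕ} {γ : ℝ} (hbox : ∀ i, i ≤ n → 0 < h i ∧ h i ≤ γ) :
    (fun i => extd (prefixOf h n) (i + 1)) ∈ Window γ :=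
  fun i => extd_prefixOf_mem_window hbox (i + 1)

variable {F : T4Family} {G : Type*} [GaugeGroup G] [MeasurableSpace G] [HaarData G]

/-- **NODE U2's OUTPUT TRANSFERS TO THE CLAMPED TABLES FROM ANY OFFSET.**  `U2Output D g₀ Cd θc` bounds
`disc (runFlow D g₀ n) (runFlow D g₀ (n+1)) j = |1∕g_n(j)² − 1∕g_{n+1}(j+1)²|` for `j ≤ n`; the clamped tables of the runs `K₀ + K`, `K₀ + K + 1`
agree with the runs at the indices `j ≤ K ≤ K₀ + K` resp. `j + 1` that `disc` reads (`T4FlagMemoryTwoRun.extd_prefixOf`), so the same `InjectedRate` holds for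
them (exponent `0`: `injectedRate_shift`). [bookkeeping] [folklore] -/
theorem injectedRate_clamped (D : FiniteEpsData F G) {g₀ : ℕ → ℝ} {Cd θc : ℝ} (hu2 : U2Output D g₀ Cd θc) (K₀ : ℕ)
    {g : ℕ → ℕ → ℝ} (hg : ∀ K, g K = extd (prefixOf (runFlow D g₀ (K₀ + K)) (K₀ + K))) :
    InjectedRate Cd 0 θc fun K j => T4CouplingMatching.disc (g K) (g (K + 1)) j := by
  intro K j hj
  have h := injectedRate_shift hu2 K₀ K j hj
  have e1 : g K j = runFlow D g₀ (K₀ + K) j := by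
    rw [hg K]; exact T4FlagMemoryTwoRun.extd_prefixOf (by omega)
  have e2 : g (K + 1) (j + 1) = runFlow D g₀ (K₀ + (K + 1)) (j + 1) := by
    rw [hg (K + 1)]; exact T4FlagMemoryTwoRun.extd_prefixOf (by omega)
  simp only [T4CouplingMatching.disc] at h ⊢
  rw [e1, e2]
  exact h

end Clamped

/-! ## §2 The join of record at the clamped tables: box AND windows read off `Tuned` -/

section Datum

variable {F : T4Family} {G : Type*} [GaugeGroup G] [MeasurableSpace G] [HaarData G]
  {C : Carriers} {ι X : Type} [MeasurableSpace ι] {σ : Type} [DecidableEq σ]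
  {R : Readings ι X} {Wset : Set (ℕ → ℝ)} {EA : Functional C C.BgA} {EB : Functional C C.BgB}
  {κ θ₅ C₅ C₉ ω C₃ θ₃ P θ' Cw a Λ E₀ γu : ℝ} {q m : ℕ} {Λm : ℕ → ℕ → ℝ} {CU : (ℕ → ℝ) → ℕ → ℝ}
  {uA : ℕ → ι → C.BgA} {uB : ℕ → ι → C.BgB} {oneA : C.BgA} {oneB : C.BgB}
  {l₀ vol : (ℕ → ℝ) → List (ULoop F) → ℝ} {K₀ : (ℕ → ℝ) → List (ULoop F) → ℕ}
  {g : (ℕ → ℝ) → List (ULoop F) → ℕ → ℕ → ℝ}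
  {T : (ℕ → ℝ) → List (ULoop F) → ℕ → Finset σ} {Bad : (ℕ → ℝ) → List (ULoop F) → ℕ → ℝ → Finset σ}
  {A B shA shB : (ℕ → ℝ) → List (ULoop F) → ℕ → ℝ → σ → ℝ} {W Wsh rO : (ℕ → ℝ) → List (ULoop F) → ℕ → ℝ}
  {μ : (ℕ → ℝ) → List (ULoop F) → ℕ → ℝ → σ → Measure ι} {fac : (ℕ → ℝ) → List (ULoop F) → ℕ → ℝ → σ → Finset C.Dom}
  {oA oB : (ℕ → ℝ) → List (ULoop F) → ℕ → ℝ → σ → ι → ℝ} {Ssz : (ℕ → ℝ) → List (ULoop F) → ℕ → ℝ → σ → ℕ → ℝ}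
  {cO RO : (ℕ → ℝ) → List (ULoop F) → ℕ → ℝ → σ → ℝ}

/-- **N27 = B5 AT THE DATUM, JOIN OF RECORD AT THE CLAMPED RUN TABLES — BOX AND WINDOWS READ OFF `Tuned`.**  As
`hybridNE7Under_of_spineRecordAtDatum_sync` (TOP LEVEL by name: N16 `NE3Shape`, N18 `NE5`, N22 `NE9 ∧ FadingMemory`, `LipBackground`,
`C.transport oneB = oneA`, signs∕rate ordering; UNDER THE PREFIX: `hU2` = the edge N17 → N27 `U2Output D g₀ Cd θc`, `hK5` = N20 · N21 · budget ·
E1∕E2 vs the genuine `schemeZ (D.scheme g₀) os (K₀+K)`, `hLink` = the (2.25)-ledger (F)(S)(M)(O′)) EXCEPT: the two runs' coupling tables are a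
table map `g g₀ os K : ℕ → ℝ` PINNED by the defining hypothesis `hg` to the CLAMPED run `extd (prefixOf (runFlow D g₀ (K₀+K)) (K₀+K))`; the
record decls' coupling window `Wset` contains `Window γᵤ` for some `γᵤ > 0` (`hWin`; N18∕N22∕`LipBackground` are typically stated ON
`Window γᵤ`); and the run-dependent K4 clause is `PolyLipGrowth` ALONE (`hG`).  Inside the proof the prefix's `γ`-threshold is shrunk to
`min γ₀ γᵤ`; then for tuned `g₀`: the box `0 < g K i ≤ γ` (`i ≤ K`) and BOTH window memberships `g K ∈ Wset`, `(i ↦ g (K+1) (i+1)) ∈ Wset`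
follow from `D.Tuned γ g g₀` (§1), and `hU2` transfers to the clamped tables (`injectedRate_clamped`).  CONCLUSION: `T4ApexHybrid.HybridNE7Under D Hβ`.
CONDITIONAL on every binder; nothing of Bałaban's instantiated; NOT a discharge. [bookkeeping] [folklore] -/
theorem hybridNE7Under_of_spineRecordAtDatum_tuned (D : FiniteEpsData F G) {Hβ : Prop} {Cd θc : ℝ}
    (hg : ∀ g₀ os K, g g₀ os K = extd (prefixOf (runFlow D g₀ (K₀ g₀ os + K)) (K₀ g₀ os + K)))
    (hγu : 0 < γu) (hWin : Window γu ⊆ Wset)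
    (h16 : NE3Shape R C₃ θ₃) (hC₃ : 0 ≤ C₃) (hgd : GaugeDominated R uA uB)
    (h18 : NE5 EA EB Wset κ θ₅ C₅) (hθ₅ : 0 ≤ θ₅) (hC₅ : 0 ≤ C₅)
    (h22 : NE9 EA Wset κ Λm ∧ FadingMemory C₉ ω Λm) (hω : 0 ≤ ω)
    (hUL : LipBackground EA Wset κ CU) (hP : 0 ≤ P) (hone : C.transport oneB = oneA)
    (hθ' : max ω θc < θ') (hθ₅' : θ₅ ≤ θ') (hθ₃' : θ₃ ≤ θ') (hθ'1 : θ' < 1) (hθ'Λ : θ' ≤ Λ)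
    (hE₀ : 0 ≤ E₀) (ha0 : 0 < a) (ha1 : a < 1) (hCd : 0 ≤ Cd) (hθc : 0 ≤ θc)
    (hU2 : D.UnderHypotheses Hβ fun g₀ => U2Output D g₀ Cd θc)
    (hK5 : D.UnderHypotheses Hβ fun g₀ => ∀ os : List (ULoop F),
      0 < l₀ g₀ os ∧ 0 < vol g₀ os ∧
        RelWeightBound (l₀ g₀ os) (T g₀ os) (A g₀ os) (B g₀ os) (Bad g₀ os) (W g₀ os) ∧
        ShellWeightBound (l₀ g₀ os) (T g₀ os) (A g₀ os) (B g₀ os) (shA g₀ os) (shB g₀ os) (Wsh g₀ os) ∧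
        (∀ K, W g₀ os K + Wsh g₀ os K < 1) ∧
        (∀ (K : ℕ) (t : ℝ), |t| ≤ l₀ g₀ os →
          T4GenFunBounds.schemeZ (D.scheme g₀) os (K₀ g₀ os + K) t = ∑ τ ∈ T g₀ os K, A g₀ os K t τ) ∧
        (∀ (K : ℕ) (t : ℝ), |t| ≤ l₀ g₀ os →
          T4GenFunBounds.schemeZ (D.scheme g₀) os (K₀ g₀ os + K + 1) t = ∑ τ ∈ T g₀ os K, B g₀ os K t τ))
    (hG : D.UnderHypotheses Hβ fun g₀ => ∀ os : List (ULoop F), PolyLipGrowth CU (g g₀ os) P q)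
    (hLink : D.UnderHypotheses Hβ fun g₀ => ∀ os : List (ULoop F),
      (∀ K t τ, A g₀ os K t τ - shA g₀ os K t τ = ∫ v, (∏ Y ∈ fac g₀ os K t τ,
        Real.exp (EA (g g₀ os K) (uA K v) Y - EA (g g₀ os K) oneA Y)) * oA g₀ os K t τ v ∂(μ g₀ os K t τ)) ∧
      (∀ K t τ, B g₀ os K t τ - shB g₀ os K t τ = ∫ v, (∏ Y ∈ fac g₀ os K t τ,
        Real.exp (EB (fun i => g g₀ os (K + 1) (i + 1)) (uB K v) Y
          - EB (fun i => g g₀ os (K + 1) (i + 1)) oneB Y)) * oB g₀ os K t τ v ∂(μ g₀ os K t τ)) ∧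
      (∀ K t, |t| ≤ l₀ g₀ os → ∀ τ ∈ T g₀ os K \ Bad g₀ os K t,
        Integrable (fun v => (∏ Y ∈ fac g₀ os K t τ,
          Real.exp (EA (g g₀ os K) (uA K v) Y - EA (g g₀ os K) oneA Y)) * oA g₀ os K t τ v) (μ g₀ os K t τ) ∧
        Integrable (fun v => (∏ Y ∈ fac g₀ os K t τ,
          Real.exp (EB (fun i => g g₀ os (K + 1) (i + 1)) (uB K v) Y
            - EB (fun i => g g₀ os (K + 1) (i + 1)) oneB Y)) * oB g₀ os K t τ v) (μ g₀ os K t τ)) ∧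
      (∀ K t, |t| ≤ l₀ g₀ os → ∀ τ ∈ T g₀ os K \ Bad g₀ os K t, ∀ Y ∈ fac g₀ os K t τ, C.scale Y ≤ K) ∧
      (∀ K t, |t| ≤ l₀ g₀ os → ∀ τ ∈ T g₀ os K \ Bad g₀ os K t, ∀ v ∈ R.dom,
        0 < oA g₀ os K t τ v ∧ 0 < oB g₀ os K t τ v) ∧
      (∀ K t, |t| ≤ l₀ g₀ os → ∀ τ ∈ T g₀ os K \ Bad g₀ os K t, ∀ v, v ∉ R.dom →
        (∏ Y ∈ fac g₀ os K t τ, Real.exp (EA (g g₀ os K) (uA K v) Y - EA (g g₀ os K) oneA Y)) *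
            oA g₀ os K t τ v = 0 ∧
        (∏ Y ∈ fac g₀ os K t τ,
          Real.exp (EB (fun i => g g₀ os (K + 1) (i + 1)) (uB K v) Y
            - EB (fun i => g g₀ os (K + 1) (i + 1)) oneB Y)) * oB g₀ os K t τ v = 0) ∧
      (∀ K t, |t| ≤ l₀ g₀ os → ∀ τ ∈ T g₀ os K \ Bad g₀ os K t, ∀ v ∈ R.dom, ∀ j ≤ K,
        |∑ Y ∈ fac g₀ os K t τ with C.scale Y = j,
            (Real.log (Real.exp (EB (fun i => g g₀ os (K + 1) (i + 1)) (uB K v) Y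
                - EB (fun i => g g₀ os (K + 1) (i + 1)) oneB Y))
              - Real.log (Real.exp (EA (g g₀ os K) (uA K v) Y - EA (g g₀ os K) oneA Y)))| ≤ Ssz g₀ os K t τ j) ∧
      (∀ K t, |t| ≤ l₀ g₀ os → ∀ τ ∈ T g₀ os K \ Bad g₀ os K t,
        Multiplicity (fac g₀ os K t τ) C.scale (fun Y => Real.exp (-(κ * C.d Y))) Cw (vol g₀ os) Λ K) ∧
      (∀ K t, |t| ≤ l₀ g₀ os → ∀ τ ∈ T g₀ os K \ Bad g₀ os K t, ∀ v ∈ R.dom,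
        |Real.log (oB g₀ os K t τ v) - Real.log (oA g₀ os K t τ v) - cO g₀ os K t τ| ≤ RO g₀ os K t τ) ∧
      (∀ K t, |t| ≤ l₀ g₀ os → ∀ τ ∈ T g₀ os K \ Bad g₀ os K t, ∀ j ≤ K,
        Ssz g₀ os K t τ j ≤ vol g₀ os * (E₀ * ((K : ℝ) + 1) ^ m * a ^ (K - j))) ∧
      (∀ K t, |t| ≤ l₀ g₀ os → ∀ τ ∈ T g₀ os K \ Bad g₀ os K t, RO g₀ os K t τ ≤ vol g₀ os * rO g₀ os K) ∧
      Summable (rO g₀ os) ∧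
      (∃ c₀ s : ℕ → ℝ, Summable s ∧ ∀ K t, |t| ≤ l₀ g₀ os → ∀ τ ∈ T g₀ os K \ Bad g₀ os K t,
        |cO g₀ os K t τ - c₀ K| ≤ vol g₀ os * s K)) :
    T4ApexHybrid.HybridNE7Under D Hβ := by
  intro hB hβ
  have H1 : ForSmallCouplings D _ := hU2 hB hβ
  have H2 : ForSmallCouplings D _ := hK5 hB hβ
  have H3 : ForSmallCouplings D _ := hG hB hβ
  have H4 : ForSmallCouplings D _ := hLink hB hβ
  obtain ⟨γ₀, hγ₀, Hγ⟩ := ((H1.and H2).and H3).and H4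
  -- shrink the `γ`-threshold to `≤ γᵤ`, so that the tuned runs' window `Window γ` sits inside `Wset`
  refine ⟨min γ₀ γu, lt_min hγ₀ hγu, fun γ hγ hγle => ?_⟩
  obtain ⟨g₁, hg₁, Hg⟩ := Hγ γ hγ (hγle.trans (min_le_left _ _))
  refine ⟨g₁, hg₁, fun gIR hgIR hgIRle g₀ ht os => ?_⟩
  obtain ⟨⟨⟨hu2, hk5⟩, hGg⟩, hlink⟩ := Hg gIR hgIR hgIRle g₀ ht
  obtain ⟨hl₀, hvol, h20, h21, hlt, hE1, hE2⟩ := hk5 os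
  obtain ⟨hfmtA, hfmtB, hint, hsc, hposO, hoff, hS, hM, hO, hSle, hRO, hrO, hcO⟩ := hlink os
  have hWγ : Window γ ⊆ Wset := fun h hh => hWin fun i => ⟨(hh i).1, (hh i).2.trans (hγle.trans (min_le_right _ _))⟩
  -- the runs stay in `]0, γ]` (Tuned), so the clamped tables are in the window and in the box
  have hrun : ∀ K i, i ≤ K₀ g₀ os + K →
      0 < runFlow D g₀ (K₀ g₀ os + K) i ∧ runFlow D g₀ (K₀ g₀ os + K) i ≤ γ := fun K i hi => (ht (K₀ g₀ os + K)).1 i hi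
  have hgA : ∀ K, g g₀ os K ∈ Wset := fun K => by
    rw [hg g₀ os K]; exact hWγ (extd_prefixOf_mem_window (hrun K))
  have hgB : ∀ K, (fun i => g g₀ os (K + 1) (i + 1)) ∈ Wset := fun K => by
    have e : (fun i => g g₀ os (K + 1) (i + 1))
        = fun i => extd (prefixOf (runFlow D g₀ (K₀ g₀ os + (K + 1))) (K₀ g₀ os + (K + 1))) (i + 1) := by
      funext i; rw [hg g₀ os (K + 1)]
    rw [e]; exact hWγ (extd_prefixOf_succ_mem_window (hrun (K + 1)))
  have hbox : ∀ K i, i ≤ K → 0 < g g₀ os K i ∧ g g₀ os K i ≤ γ := fun K i hi => by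
    rw [hg g₀ os K, T4FlagMemoryTwoRun.extd_prefixOf (show i ≤ K₀ g₀ os + K by omega)]
    exact hrun K i (by omega)
  have hinj : InjectedRate Cd 0 θc fun K j => T4CouplingMatching.disc (g g₀ os K) (g g₀ os (K + 1)) j :=
    injectedRate_clamped D hu2 (K₀ g₀ os) (hg g₀ os)
  exact ⟨l₀ g₀ os, vol g₀ os, K₀ g₀ os, hl₀, hvol,
    stringHybridNE7_of_spineRecord_sync (g := g g₀ os) (D.scheme g₀) os (K₀ g₀ os) h20 h21 hlt hE1 hE2 h22 hω hUL (hGg os)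
      hP h18 hθ₅ hC₅ h16 hC₃ hgd hinj hCd hθc hbox hgA hgB hθ' hθ₅' hθ₃' hθ'1 hθ'Λ hfmtA hfmtB hint hsc hposO hoff hS hM
      hO hvol hE₀ ha0 ha1 hSle hRO hrO hone hcO⟩

end Datum

end Summit.QuantumFields.YangMills.Theorems.BalabanUVNodesN27SpineRecord
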